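import Summits.ABC.ABC.Theses.FeketeScales
import Summits.ABC.ABC.Theorems.FeketeScalesSparseGoodScalesWindow
import HarnessLib

/-!
# Crux `SparseGoodScales` (stmt-ABC-2161) — line `Sketch` (vertical × horizontal factorisation),
# lead prover's SKELETON v2 (composition landed, p96117)

The crux (verbatim the route decl `Summit.ABC.ABC.Theses.FeketeScales.SparseGoodScales`: for every
`δ > 0` there are arbitrarily large scales `R` with `c ≤ R^{1+δ}` for every abc triple of radical
`≤ R`) is concluded BY NAME by `sparseGoodScales_proof`, through the composition
`Summit.ABC.ABC.Theorems.sparseGoodScales_of_boundedQuality_of_windowed`, LANDED in the tree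
(p96117, `Summits/ABC/ABC/Theorems/FeketeScalesSparseGoodScalesWindow.lean`, registered sub-goal of
this crux) and imported here; `sorry` occurs only in the two registered stubs `stub_*`.  Every
stub is written in the tree's vocabulary only (no new definitions), so that each can land verbatim
as a `--supports stmt-ABC-2161` Theorems file.

## Status after wave 1
* `stub_boundedQuality` — worker reply `stub-blocked: Summit.ABC.ABC.Theses.FeketeScales.
  ScaleSubmultiplicativity (stmt-ABC-2160)`; the stub is moreover DEFINITIONALLY the open crux
  `Summit.ABC.ABC.Theses.FermatTwistHeights.PolynomialABC` (item stmt-ABC-1724) of route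
  FermatTwistHeights; no unconditional source in the tree (every `c ≤ C·rad^A` theorem takes an
  open hypothesis; Literature's best is the unproved named fact `stewart_yu`).  In-route discharge
  landed: `Summit.ABC.ABC.Theorems.sparseGoodScales_boundedQuality_of_scaleSubmultiplicativity`.
* `stub_windowedGoodScales` — held by the lead; OPEN, no engine (BarrierNotes-r1-k2 N3/N5);
  landed: `SparseGoodScales → WGS` and `BQ → (SparseGoodScales ↔ WGS)` (p96117), so the stub is
  exactly the crux's residue modulo the vertical factor.

## The line (idea card `Ideas/bounded-quality-times-radical-droughts.md`, ideator 2)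

* `stub_boundedQuality` (VERTICAL): weak abc with SOME exponent, `∃ A C, c ≤ C · rad^A` — verbatim
  the conclusion of the proved support item `PolynomialAbcOfSubmult` (stmt-ABC-2163); open
  standalone (beyond every Baker-method bound), supplied IN-ROUTE by the sister crux
  `ScaleSubmultiplicativity` (stmt-ABC-2160) via `polynomialAbcOfSubmult_proof` and the discharged
  abc.S25 (`finite_setOf_isABCTriple_primeFactors_subset_holds`).
* `stub_windowedGoodScales` (HORIZONTAL, the bet): for every `δ > 0`, every window ratio `Λ > 1`
  and every `N` there is `R ≥ N` such that every abc triple with `rad ≤ R < rad^Λ` (radical in the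
  window `(R^{1/Λ}, R]`) has `c ≤ R^{1+δ}`.  Implied by the crux (drop the window); equivalent to
  it under `stub_boundedQuality`; no heights below the window are constrained.
* composition (PROVED, landed p96117 as
  `Summit.ABC.ABC.Theorems.sparseGoodScales_of_boundedQuality_of_windowed`): height truncation by the window — below the window
  (`rad^Λ ≤ R`) the polynomial bound with `Λ = 2·max(A,1)` gives `c ≤ max(C,1)·R^{1/2} ≤ R` once
  `R ≥ max(C,1)^2`; inside the window the horizontal stub gives `c ≤ R^{1+δ}` directly.

Disproof used: none exists yet (`Cruxes/SparseGoodScales/Disproof.lean` absent at registration).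
-/

set_option linter.dupNamespace false

namespace Summit.ABC.ABC.Cruxes.SparseGoodScales.DroughtFactorization

open Literature.NumberTheory.DiophantineGeometry

/-- **STUB 1 (vertical): bounded quality / polynomial abc.**  There are real `A, C` with
`c ≤ C · rad(abc)^A` for every abc triple.  Verbatim the conclusion of
`Summit.ABC.ABC.Theses.FeketeScales.PolynomialAbcOfSubmult`; in-route it follows from the sister
crux `ScaleSubmultiplicativity` (stmt-ABC-2160). Open standalone. -/
theorem stub_boundedQuality :
    ∃ A C : ℝ, ∀ a b c : ℕ, IsABCTriple a b c → (c : ℝ) ≤ C * ((rad a b c : ℕ) : ℝ) ^ A := by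
  sorry

/-- **STUB 2 (horizontal, the bet): windowed good scales.**  For every `δ > 0`, every `Λ > 1`
and every `N` there is a scale `R ≥ N` at which every abc triple whose radical lies in the window
`(R^{1/Λ}, R]` (written `rad ≤ R ∧ R < rad^Λ`) has `c ≤ R^{1+δ}`. -/
theorem stub_windowedGoodScales :
    ∀ δ : ℝ, 0 < δ → ∀ Λ : ℝ, 1 < Λ → ∀ N : ℕ, ∃ R : ℕ, N ≤ R ∧ ∀ a b c : ℕ, IsABCTriple a b c →
      rad a b c ≤ R → (R : ℝ) < ((rad a b c : ℕ) : ℝ) ^ Λ → (c : ℝ) ≤ (R : ℝ) ^ (1 + δ) := by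
  sorry

/-- **The crux, concluded BY NAME from the two registered stubs** (the skeleton's deciding
theorem): `SparseGoodScales` from `stub_boundedQuality` and `stub_windowedGoodScales` through
the landed composition `Summit.ABC.ABC.Theorems.sparseGoodScales_of_boundedQuality_of_windowed`. -/
theorem sparseGoodScales_proof : Theses.FeketeScales.SparseGoodScales :=
  Summit.ABC.ABC.Theorems.sparseGoodScales_of_boundedQuality_of_windowed
    stub_boundedQuality stub_windowedGoodScales

end Summit.ABC.ABC.Cruxes.SparseGoodScales.DroughtFactorization
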